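import Mathlib.Data.ZMod.ValMinAbs
import Mathlib.Tactic
import HarnessLib

/-!
# Cyclic frames (coarse cells) on the discrete circle `ℤ/N`

Coarse-graining a discrete torus `(ℤ/N)^d` whose side `N` is NOT a multiple of the cell scale `b`
(odd or prime sides `N = 2S+1` are forced by transfer-matrix / reflection arguments) needs cells of
UNEQUAL lengths. This file provides the one-dimensional combinatorics, axis by axis:

* `IsTorusFrame N b q` — a *cyclic frame of scale `b`*: a label map `q : ℤ/N → ℤ/m` stepping by
  `0` or `+1` along the circle whose fibres are cyclic intervals of length in `[b, 2b]`;
* the explicit frame `axisFrame N b μ : ℤ/N → ℤ/(μ+1)`, `x ↦ min (⌊x.val / b⌋) μ` (cells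
  `[jb, (j+1)b)` for `j < μ`, the last cell `[μ b, N)` absorbing the remainder), which is a torus
  frame as soon as `(μ+1) b ≤ N < (μ+2) b` (`isTorusFrame_axisFrame`); such a `μ` exists for every
  `N ≥ b ≥ 1` (`axisFrame_bounds_of_div`);
* the two metric facts consumed by multiscale arguments: labels CONTRACT cyclic distances by `b`
  (`axisFrame_dist_le`: `d(q x, q y) ≤ d(x, y)/b + 1`) and EXPAND them by less than `2b`
  (`dist_lt_axisFrame_dist`: `d(x, y) + 1 ≤ 2b (d(q x, q y) + 1)`), cyclic distances being
  `|valMinAbs (x - y)|`;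
* counting: the fibre of a label meets at most `2b/b₀ + 2` sub-blocks of scale `b₀`
  (`card_image_corner_filter_axisFrame_le`);
* the elementary estimate behind "no wrap-around for time shifts `t ≤ S` on the odd circle
  `ℤ/(2S+1)`": `t ≤ |valMinAbs (δ - t)| + |δ|` (`le_natAbs_valMinAbs_sub_add`).

Everything is elementary (`omega`-level) arithmetic on representatives; no measure theory.
Sources: standard (block-spin / coarse-graining constructions on periodic lattices, e.g.
Georgii, *Gibbs Measures and Phase Transitions* (2011), Ch. 8 and Rem. 1.24, for the role of
coarse cells; the arithmetic itself is folklore).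
-/

namespace Literature.Probability.LatticeModels

/-! ### Cyclic frames -/

/-- **Cyclic frame** of scale `b` on `ℤ/N`: a label map stepping by `0` or `1` whose fibres are cyclic
intervals of length in `[b, 2b]` (odd / prime torus sides force unequal cells). [folklore] -/
def IsTorusFrame (N b : ℕ) {m : ℕ} (q : ZMod N → ZMod m) : Prop :=
  (∀ x : ZMod N, q (x + 1) = q x ∨ q (x + 1) = q x + 1) ∧
    ∀ c : ZMod m, ∃ (a : ZMod N) (ℓ : ℕ), b ≤ ℓ ∧ ℓ ≤ 2 * b ∧
      ∀ x : ZMod N, q x = c ↔ ∃ j : ℕ, j < ℓ ∧ x = a + j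

/-- Integer label of the explicit frame of scale `b` with `μ + 1` cells: `min (u / b) μ`. [folklore] -/
def frameLabel (b μ u : ℕ) : ℕ := min (u / b) μ

/-- **The explicit axis frame** on `ℤ/N` of scale `b` with `μ + 1` cells: cell `j < μ` is the cyclic
interval `[j b, (j+1) b)`, cell `μ` is `[μ b, N)` (it absorbs the remainder `N - (μ+1) b < b`). [folklore] -/
def axisFrame (N b μ : ℕ) (x : ZMod N) : ZMod (μ + 1) :=
  ((frameLabel b μ x.val : ℕ) : ZMod (μ + 1))

variable {N b μ : ℕ}

/-- Labels are at most `μ`. [folklore] -/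
theorem frameLabel_le (u : ℕ) : frameLabel b μ u ≤ μ := min_le_right _ _

/-- Labels are monotone in the representative. [folklore] -/
theorem frameLabel_mono {u v : ℕ} (h : u ≤ v) : frameLabel b μ u ≤ frameLabel b μ v :=
  min_le_min_right _ (Nat.div_le_div_right h)

/-- The cell of `u` starts at or before `u`: `frameLabel u * b ≤ u`. [folklore] -/
theorem frameLabel_mul_le (u : ℕ) : frameLabel b μ u * b ≤ u :=
  (Nat.mul_le_mul_right _ (min_le_left _ _)).trans (Nat.div_mul_le_self _ _)

/-- `u < (frameLabel u + 1) b` unless the label is the last one. [folklore] -/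
theorem lt_frameLabel_mul_add_or (hb : 0 < b) (u : ℕ) :
    u < frameLabel b μ u * b + b ∨ frameLabel b μ u = μ := by
  unfold frameLabel
  rcases le_total (u / b) μ with h | h
  · rw [min_eq_left h]; exact Or.inl (Nat.lt_div_mul_add hb)
  · exact Or.inr (min_eq_right h)

/-- `u < (frameLabel u + 2) b` for representatives `u < N < (μ + 2) b`. [folklore] -/
theorem lt_frameLabel_mul_add_two_mul (hb : 0 < b) (h2 : N < μ * b + 2 * b) {u : ℕ} (hu : u < N) :
    u < frameLabel b μ u * b + 2 * b := by
  rcases lt_frameLabel_mul_add_or (μ := μ) hb u with h | h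
  · omega
  · rw [h]; omega

/-- The value of the frame label is `frameLabel`. [folklore] -/
theorem val_axisFrame (x : ZMod N) : (axisFrame N b μ x).val = frameLabel b μ x.val :=
  ZMod.val_cast_of_lt (Nat.lt_succ_of_le (frameLabel_le _))

/-- Cyclic distance on `ℤ/N` between representatives `v ≤ u < N`. [folklore] -/
theorem natAbs_valMinAbs_natCast_sub {u v : ℕ} (hu : u < N) (hvu : v ≤ u) :
    (((u : ZMod N) - (v : ZMod N)).valMinAbs).natAbs = min (u - v) (N - (u - v)) := by
  haveI : NeZero N := ⟨by omega⟩
  rw [← Nat.cast_sub hvu, ZMod.valMinAbs_natAbs_eq_min, ZMod.val_natCast,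
    Nat.mod_eq_of_lt (by omega)]

variable [NeZero N]

/-- Sites of one cell have representatives in `[c.val · b, c.val · b + 2 b)`. [folklore] -/
theorem axisFrame_eq_imp (hb : 0 < b) (h2 : N < μ * b + 2 * b) {x : ZMod N} {c : ZMod (μ + 1)}
    (h : axisFrame N b μ x = c) : c.val * b ≤ x.val ∧ x.val < c.val * b + 2 * b := by
  have hl : frameLabel b μ x.val = c.val := by rw [← val_axisFrame, h]
  refine ⟨?_, ?_⟩
  · rw [← hl]; exact frameLabel_mul_le _
  · rw [← hl]; exact lt_frameLabel_mul_add_two_mul hb h2 x.val_lt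

/-- **Step property** of the explicit frame: `q (x+1) = q x` or `q x + 1` (for `(μ+1) b ≤ N`). [folklore] -/
theorem axisFrame_add_one (hb : 0 < b) (h1 : μ * b + b ≤ N) (x : ZMod N) :
    axisFrame N b μ (x + 1) = axisFrame N b μ x ∨
      axisFrame N b μ (x + 1) = axisFrame N b μ x + 1 := by
  have hx1 : x + 1 = ((x.val + 1 : ℕ) : ZMod N) := by rw [Nat.cast_add_one, ZMod.natCast_zmod_val]
  have hxv := x.val_lt
  by_cases hlast : x.val + 1 < N
  · have hv : (x + 1).val = x.val + 1 := by rw [hx1, ZMod.val_natCast, Nat.mod_eq_of_lt hlast]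
    have hstep : frameLabel b μ (x.val + 1) = frameLabel b μ x.val ∨
        frameLabel b μ (x.val + 1) = frameLabel b μ x.val + 1 := by
      unfold frameLabel
      rw [Nat.succ_div]
      split_ifs <;> omega
    rcases hstep with h | h
    · left; unfold axisFrame; rw [hv, h]
    · right; unfold axisFrame; rw [hv, h, Nat.cast_add_one]
  · have hN : x.val + 1 = N := by omega
    right
    have h0 : x + 1 = 0 := by rw [hx1, hN, ZMod.natCast_self]
    have hμ : frameLabel b μ x.val = μ := by
      unfold frameLabel
      apply min_eq_right
      rw [Nat.le_div_iff_mul_le hb]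
      omega
    have hμ1 : ((μ : ℕ) : ZMod (μ + 1)) + 1 = 0 := by rw [← Nat.cast_add_one, ZMod.natCast_self]
    unfold axisFrame
    rw [h0, ZMod.val_zero, hμ, hμ1]
    simp [frameLabel]

/-- **Fibre property** of the explicit frame: every cell is a cyclic interval of length in `[b, 2b]`
(for `(μ+1) b ≤ N < (μ+2) b`). [folklore] -/
theorem axisFrame_fibre (hb : 0 < b) (h1 : μ * b + b ≤ N) (h2 : N < μ * b + 2 * b)
    (c : ZMod (μ + 1)) :
    ∃ (a : ZMod N) (ℓ : ℕ), b ≤ ℓ ∧ ℓ ≤ 2 * b ∧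
      ∀ x : ZMod N, axisFrame N b μ x = c ↔ ∃ j : ℕ, j < ℓ ∧ x = a + j := by
  have hc : c.val ≤ μ := Nat.lt_succ_iff.1 c.val_lt
  have key : ∀ x : ZMod N, axisFrame N b μ x = c ↔ frameLabel b μ x.val = c.val := fun x => by
    constructor
    · intro h; rw [← val_axisFrame, h]
    · intro h; apply ZMod.val_injective; rw [val_axisFrame, h]
  rcases hc.lt_or_eq with hlt | heq
  · refine ⟨((c.val * b : ℕ) : ZMod N), b, le_rfl, by omega, fun x => ?_⟩
    rw [key]
    constructor
    · intro h
      have hlo := frameLabel_mul_le (b := b) (μ := μ) x.val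
      rcases lt_frameLabel_mul_add_or (μ := μ) hb x.val with hhi | hhi
      · rw [h] at hlo hhi
        refine ⟨x.val - c.val * b, by omega, ?_⟩
        rw [← Nat.cast_add, Nat.add_sub_cancel' hlo, ZMod.natCast_zmod_val]
      · omega
    · rintro ⟨j, hj, rfl⟩
      have hcb : (c.val + 1) * b ≤ μ * b := Nat.mul_le_mul_right b hlt
      rw [Nat.succ_mul] at hcb
      have hlt' : c.val * b + j < N := by omega
      rw [← Nat.cast_add, ZMod.val_natCast, Nat.mod_eq_of_lt hlt']
      unfold frameLabel
      rw [Nat.mul_comm, Nat.mul_add_div hb, Nat.div_eq_of_lt hj, add_zero]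
      exact min_eq_left hlt.le
  · refine ⟨((μ * b : ℕ) : ZMod N), N - μ * b, by omega, by omega, fun x => ?_⟩
    rw [key, heq]
    constructor
    · intro h
      have hlo := frameLabel_mul_le (b := b) (μ := μ) x.val
      rw [h] at hlo
      refine ⟨x.val - μ * b, by have := x.val_lt; omega, ?_⟩
      rw [← Nat.cast_add, Nat.add_sub_cancel' hlo, ZMod.natCast_zmod_val]
    · rintro ⟨j, hj, rfl⟩
      have hlt' : μ * b + j < N := by omega
      rw [← Nat.cast_add, ZMod.val_natCast, Nat.mod_eq_of_lt hlt']
      unfold frameLabel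
      rw [Nat.mul_comm, Nat.mul_add_div hb]
      exact min_eq_right (Nat.le_add_right _ _)

/-- **Existence of frames**: the explicit frame is a torus frame of scale `b` whenever
`(μ+1) b ≤ N < (μ+2) b`. [folklore] -/
theorem isTorusFrame_axisFrame (hb : 0 < b) (h1 : μ * b + b ≤ N) (h2 : N < μ * b + 2 * b) :
    IsTorusFrame N b (axisFrame N b μ) :=
  ⟨axisFrame_add_one hb h1, axisFrame_fibre hb h1 h2⟩

omit [NeZero N] in
/-- The canonical number of cells: for `0 < b ≤ N`, `μ + 1 := N / b` satisfies
`(μ+1) b ≤ N < (μ+2) b`. [folklore] -/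
theorem axisFrame_bounds_of_div (hb : 0 < b) (hbN : b ≤ N) :
    (N / b - 1) * b + b ≤ N ∧ N < (N / b - 1) * b + 2 * b := by
  have hM1 : 1 ≤ N / b := (Nat.le_div_iff_mul_le hb).2 (by simpa using hbN)
  obtain ⟨M', hMM'⟩ : ∃ M', N / b = M' + 1 := ⟨N / b - 1, (Nat.sub_add_cancel hM1).symm⟩
  have hle : N / b * b ≤ N := Nat.div_mul_le_self _ _
  have hlt : N < N / b * b + b := Nat.lt_div_mul_add hb
  rw [hMM'] at hle hlt ⊢
  rw [Nat.add_sub_cancel, Nat.add_mul, Nat.one_mul] at *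
  omega

/-! ### The two metric facts: labels contract distances by `b` and expand them by `< 2b` -/

omit [NeZero N] in
/-- Arithmetic core of `axisFrame_dist_le`. [folklore] -/
theorem frameLabel_dist_core_contract {u v p r : ℕ} (hb : 0 < b) (h1 : μ * b + b ≤ N) (huN : u < N)
    (hle : v ≤ u) (hrp : r ≤ p) (hpμ : p ≤ μ) (hpu : p * b ≤ u) (hrv : r * b ≤ v)
    (hu2 : u < p * b + b ∨ p = μ) (hv2 : v < r * b + b ∨ r = μ) :
    min (p - r) (μ + 1 - (p - r)) ≤ min (u - v) (N - (u - v)) / b + 1 := by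
  have hi : p - r ≤ (u - v) / b + 1 := by
    rcases Nat.lt_or_ge p (r + 1) with hpr | hpr
    · rw [show p - r = 0 by omega]; exact Nat.zero_le _
    · rcases hv2 with hv2 | hv2
      · obtain ⟨e, rfl⟩ := Nat.exists_eq_add_of_le hpr
        have he : e ≤ (u - v) / b := by
          rw [Nat.le_div_iff_mul_le hb]
          have := Nat.add_mul (r + 1) e b
          have := Nat.add_mul r 1 b
          omega
        omega
      · exact absurd hpμ (by omega)
  have hii : μ + 1 - (p - r) ≤ (N - (u - v)) / b + 1 := by
    rcases hu2 with hu2 | hu2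
    · have hle' : μ - (p - r) ≤ (N - (u - v)) / b := by
        rw [Nat.le_div_iff_mul_le hb]
        obtain ⟨f, hf⟩ := Nat.exists_eq_add_of_le hpμ
        have hfr' : μ - (p - r) = f + r := by omega
        rw [hfr', Nat.add_mul]
        have := Nat.add_mul p f b
        rw [hf] at h1
        omega
      omega
    · have hle' : r ≤ (N - (u - v)) / b := by
        rw [Nat.le_div_iff_mul_le hb]; omega
      omega
  rcases le_total (u - v) (N - (u - v)) with h | h
  · rw [min_eq_left h]; exact (min_le_left _ _).trans hi
  · rw [min_eq_right h]; exact (min_le_right _ _).trans hii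

omit [NeZero N] in
/-- Arithmetic core of `dist_lt_axisFrame_dist`. [folklore] -/
theorem frameLabel_dist_core_expand {u v p r : ℕ} (h2 : N < μ * b + 2 * b)
    (hrp : r ≤ p) (hpμ : p ≤ μ) (hpu : p * b ≤ u) (hrv : r * b ≤ v)
    (hu3 : u < p * b + 2 * b) (hv3 : v < r * b + 2 * b) :
    min (u - v) (N - (u - v)) + 1 ≤ 2 * b * (min (p - r) (μ + 1 - (p - r)) + 1) := by
  obtain ⟨e, rfl⟩ := Nat.exists_eq_add_of_le hrp
  obtain ⟨f, hf⟩ := Nat.exists_eq_add_of_le hpμ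
  have h2b : 2 * b * (e + 1) = 2 * (e * b) + 2 * b := by ring
  have h2b' : 2 * b * (f + r + 2) = 2 * (f * b) + 2 * (r * b) + 4 * b := by ring
  have hre := Nat.add_mul r e b
  have hrf := Nat.add_mul (r + e) f b
  rcases le_total (r + e - r) (μ + 1 - (r + e - r)) with h | h
  · rw [min_eq_left h, Nat.add_sub_cancel_left, h2b]
    omega
  · rw [min_eq_right h]
    have hsimp : μ + 1 - (r + e - r) + 1 = f + r + 2 := by omega
    rw [hsimp, h2b']
    rw [hf] at h2
    omega

/-- **Labels contract distances by `b`**: the cyclic distance of two labels is at most the cyclic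
distance of the sites divided by `b`, plus one (for `(μ+1) b ≤ N`). [folklore] -/
theorem axisFrame_dist_le (hb : 0 < b) (h1 : μ * b + b ≤ N) (x y : ZMod N) :
    ((axisFrame N b μ x - axisFrame N b μ y).valMinAbs).natAbs ≤
      ((x - y).valMinAbs).natAbs / b + 1 := by
  wlog hle : y.val ≤ x.val generalizing x y
  · rw [← neg_sub y x, ZMod.natAbs_valMinAbs_neg, ← neg_sub (axisFrame N b μ y),
      ZMod.natAbs_valMinAbs_neg]
    exact this y x (not_le.mp hle).le
  have huN : x.val < N := x.val_lt
  have hxy : ((x - y).valMinAbs).natAbs = min (x.val - y.val) (N - (x.val - y.val)) := by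
    conv_lhs => rw [← ZMod.natCast_zmod_val x, ← ZMod.natCast_zmod_val y]
    exact natAbs_valMinAbs_natCast_sub huN hle
  have hrp : frameLabel b μ y.val ≤ frameLabel b μ x.val := frameLabel_mono hle
  have hpμ : frameLabel b μ x.val ≤ μ := frameLabel_le _
  have hfr : ((axisFrame N b μ x - axisFrame N b μ y).valMinAbs).natAbs =
      min (frameLabel b μ x.val - frameLabel b μ y.val)
        (μ + 1 - (frameLabel b μ x.val - frameLabel b μ y.val)) :=
    natAbs_valMinAbs_natCast_sub (N := μ + 1) (Nat.lt_succ_of_le hpμ) hrp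
  rw [hxy, hfr]
  exact frameLabel_dist_core_contract hb h1 huN hle hrp hpμ (frameLabel_mul_le _)
    (frameLabel_mul_le _) (lt_frameLabel_mul_add_or hb _) (lt_frameLabel_mul_add_or hb _)

/-- **Labels expand distances by at most `2b`**: the cyclic distance of two sites is less than `2 b`
times (the cyclic distance of their labels plus one) (for `N < (μ+2) b`). [folklore] -/
theorem dist_lt_axisFrame_dist (hb : 0 < b) (h2 : N < μ * b + 2 * b) (x y : ZMod N) :
    ((x - y).valMinAbs).natAbs + 1 ≤
      2 * b * (((axisFrame N b μ x - axisFrame N b μ y).valMinAbs).natAbs + 1) := by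
  wlog hle : y.val ≤ x.val generalizing x y
  · rw [← neg_sub y x, ZMod.natAbs_valMinAbs_neg, ← neg_sub (axisFrame N b μ y),
      ZMod.natAbs_valMinAbs_neg]
    exact this y x (not_le.mp hle).le
  have huN : x.val < N := x.val_lt
  have hxy : ((x - y).valMinAbs).natAbs = min (x.val - y.val) (N - (x.val - y.val)) := by
    conv_lhs => rw [← ZMod.natCast_zmod_val x, ← ZMod.natCast_zmod_val y]
    exact natAbs_valMinAbs_natCast_sub huN hle
  have hrp : frameLabel b μ y.val ≤ frameLabel b μ x.val := frameLabel_mono hle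
  have hpμ : frameLabel b μ x.val ≤ μ := frameLabel_le _
  have hfr : ((axisFrame N b μ x - axisFrame N b μ y).valMinAbs).natAbs =
      min (frameLabel b μ x.val - frameLabel b μ y.val)
        (μ + 1 - (frameLabel b μ x.val - frameLabel b μ y.val)) :=
    natAbs_valMinAbs_natCast_sub (N := μ + 1) (Nat.lt_succ_of_le hpμ) hrp
  rw [hxy, hfr]
  exact frameLabel_dist_core_expand h2 hrp hpμ (frameLabel_mul_le _) (frameLabel_mul_le _)
    (lt_frameLabel_mul_add_two_mul hb h2 huN) (lt_frameLabel_mul_add_two_mul hb h2 (hle.trans_lt huN))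

/-! ### Counting sub-blocks per cell; time shifts on the odd circle -/

/-- **Sub-blocks met by one cell**: the corners `⌊u/b₀⌋ b₀` of the sites `u` of one cell of the frame
of scale `b` number at most `2b/b₀ + 2` (cell representatives lie in a window of length `2b`). [folklore] -/
theorem card_image_corner_filter_axisFrame_le {b₀ : ℕ} (hb₀ : 0 < b₀) (hb : 0 < b)
    (h2 : N < μ * b + 2 * b) (c : ZMod (μ + 1)) :
    ((Finset.univ.filter fun u : ZMod N => axisFrame N b μ u = c).image
      fun u : ZMod N => (((u.val / b₀ * b₀ : ℕ)) : ZMod N)).card ≤ 2 * b / b₀ + 2 := by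
  set lo := c.val * b
  have hsub : ((Finset.univ.filter fun u : ZMod N => axisFrame N b μ u = c).image
      fun u : ZMod N => (((u.val / b₀ * b₀ : ℕ)) : ZMod N)) ⊆
      (Finset.Icc (lo / b₀) ((lo + 2 * b) / b₀)).image fun k : ℕ => ((k * b₀ : ℕ) : ZMod N) := by
    intro y hy
    simp only [Finset.mem_image, Finset.mem_filter, Finset.mem_univ, true_and] at hy
    obtain ⟨u, hu, rfl⟩ := hy
    obtain ⟨h1, h3⟩ := axisFrame_eq_imp hb h2 hu
    exact Finset.mem_image.2 ⟨u.val / b₀,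
      Finset.mem_Icc.2 ⟨Nat.div_le_div_right h1, Nat.div_le_div_right h3.le⟩, rfl⟩
  refine (Finset.card_le_card hsub).trans (Finset.card_image_le.trans ?_)
  rw [Nat.card_Icc, tsub_le_iff_right]
  have : (lo + 2 * b) / b₀ ≤ lo / b₀ + 2 * b / b₀ + 1 := by
    rw [Nat.add_div hb₀]; split_ifs <;> omega
  omega

omit [NeZero N] in
/-- **No wrap-around on the odd circle**: on `ℤ/(2S+1)`, a time shift `t ≤ S` of an integer offset `δ`
has cyclic size at least `t - |δ|`. [folklore] -/
theorem le_natAbs_valMinAbs_sub_add {S t : ℕ} (ht : t ≤ S) (δ : ℤ) :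
    t ≤ (((δ - t : ℤ) : ZMod (2 * S + 1)).valMinAbs).natAbs + δ.natAbs := by
  set v := (((δ - t : ℤ) : ZMod (2 * S + 1)).valMinAbs) with hv
  have h1 : ((v : ℤ) : ZMod (2 * S + 1)) = ((δ - t : ℤ) : ZMod (2 * S + 1)) := ZMod.coe_valMinAbs _
  rw [ZMod.intCast_eq_intCast_iff, Int.modEq_iff_dvd] at h1
  obtain ⟨j, hj⟩ := h1
  have h2 : v.natAbs ≤ (2 * S + 1) / 2 := ZMod.natAbs_valMinAbs_le _
  push_cast at hj
  rcases Int.natAbs_eq v with hva | hva <;> rcases Int.natAbs_eq δ with hda | hda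
  all_goals
    rcases lt_trichotomy j 0 with hj0 | rfl | hj0
    · have : (2 * S + 1 : ℤ) * j ≤ -(2 * S + 1) := by nlinarith
      omega
    · omega
    · have : (2 * S + 1 : ℤ) ≤ (2 * S + 1) * j := by nlinarith
      omega

end Literature.Probability.LatticeModels
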